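import Summits.BirchSwinnertonDyer.BirchSwinnertonDyer.Theorems.GoldfeldK12AdditiveTwoLinks
import Summits.BirchSwinnertonDyer.BirchSwinnertonDyer.Theorems.CongruentShaFreeCutLinkBStructure
import Summits.BirchSwinnertonDyer.BirchSwinnertonDyer.Theorems.GoldfeldAllTwistsTwoConverseSplitGlue
import Literature.NumberTheory.EllipticCurves.ComplexMultiplicationHasCMProofs
import HarnessLib

set_option linter.dupNamespace false -- namespace `…BirchSwinnertonDyer.BirchSwinnertonDyer…` is the cell's (D-0017 nested layout)
set_option autoImplicit false

/-!
# Crux K12₂″ (item 20044) — STRUCTURE of the two-adic-links cut: Link A-corank is NECESSARY for the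
# parent K12₂′, Link B is Link A-corank + the parent's content at the Heegner point, and the pair
# {Link A-corank, Link B} is an EXACT decomposition of K12₂′ modulo the route's published inputs

Cell `bsd-goldfeld`, prover seat `bsd-goldfeld-s1p-c201` (gen 5), `--supports stmt-BirchSwinnertonDyer-20044`.
Sequel of `GoldfeldK12AdditiveTwoLinks` (p451298: `@[conjecture] TwoAdicControlOfCorankOneCMSeven` = Link
A-corank, `@[conjecture] TwoAdicCharValueEqHeegnerLogSqCMSeven` = Link B, and links ⟹ K12₂″ BY NAME). THEOREMS
ONLY; nothing here proves either link, K12₂″, K12₂′ or any case of BSD. The point of the file is the kernel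
bookkeeping a planner needs before registering a «two-adic-links-cm7» skeleton (TRANSFER-CN100-LINKS §2, «decide
on what lands»): which stub carries what, checked rather than asserted — the sibling cell did the same for its
cut (`CongruentShaFreeCutLinkBStructure` / `…LinkBHalves`, whose GENERIC §1 lemmas are reused here by name).

## Results (K12₂′ = the parent `RankOneTwoConverseCMSevenAtAnyTwo`: `∀` elliptic `W/ℚ` with `j = −3375` or
## `16581375`, `corank_{ℤ₂} Sel_{2^∞}(W) = 1 ⟹ ord_{s=1} L(W,s) = 1`; = K12₂″ + BCST Thm A by the CLOSED glue 20046)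

§1 `mordellWeilRank_eq_selmerCorank_two_of_le_one`, `analyticRank_eq_selmerCorank_two_of_le_one`: for EVERY
elliptic `V/ℚ` with `j(V) = −3375` and `corank₂ ≤ 1`, `rank V(ℚ) = corank₂ = ord_{s=1} L(V,s)` — granted K12₂′,
GZK over `ℚ` (`rank_eq_analyticRank_of_analyticRank_le_one`) and the Burungale–Tian rank-ZERO CM converse
(`burungaleTian_analyticRank_eq_zero_of_selmerCorank_eq_zero_of_hasCM`, a conjunct of the route's
`PublishedFactsAllTwists`). No minimality, no reduction type: the parent is model-free.

§2 Over a quadratic `K`: `corank_{ℤ₂} Sel_{2^∞}(W/K) = 1 ⟹ rank W(K) = 1 ∧ #Ш(W/K)[2^∞] < ∞` and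
`ord_{s=1} L(W/K, s) = 1` (`rankOne_finiteSha_baseChange_of_atAnyTwo`, `analyticRankEK_eq_one_of_atAnyTwo`):
the corank splits as `corank W + corank W^{(d_K)} = 1` (T. Dokchitser), both summands are `≤ 1`, both curves
have `j = −3375`, so §1 applies to each; Artin formalism.

§3 NECESSITY OF LINK A-CORANK: `twoAdicControlOfCorankOneCMSeven_of_atAnyTwo_of_poitouTate` — K12₂′ + GZK +
Poitou–Tate ⟹ Link A-corank (at a corank-one datum §2 gives rank one and finite Ш over `K`, and the RANK form
is the kernel theorem `hasCharValuationAt_of_rankOne_of_poitouTate` of the links file); hence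
`…_of_crux_of_thmA_of_poitouTate`: K12₂″ + BCST Thm A (item 20045) + GZK + PT ⟹ Link A-corank. So Link
A-corank is NOT an over-strong stub: any proof of the route's rank axis proves it (modulo PT).

§4 LINK B FROM LINK A-CORANK + THE PARENT: `twoAdicCharValueEqHeegnerLogSqCMSeven_of_controlCorank_of_atAnyTwo`
— Link A-corank + K12₂′ + Burungale–Tian rank-0 + Modularity + Gross–Zagier ⟹ Link B (at a corank-one datum
`ord_{s=1} L(W/K,s) = 1` by §2, so the Heegner point is non-torsion by Gross–Zagier, and given Link A's
generator `F` with `F(0) ≠ 0` the identity `F(0) = u·log²` holds with `u = F(0)/log² ≠ 0` — the sibling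
cell's generic `charValueEqLogSqAt_of_hasCharValuationAt_of_not_isOfFinAddOrder`, `log_ω P = 0 ↔ P` torsion).
READING: in the free-`u` currency Link B carries NO `2`-adic information beyond Link A-corank + «corank one ⟹
`P_K` non-torsion»; granted Link A-corank it is EQUIVALENT to that non-torsion statement
(`twoAdicCharValueEqHeegnerLogSqCMSeven_iff_heegnerNonTorsion_of_controlCorank`, over ALL auxiliary `K` of the
links, i.e. without the leaf's `L(W^{(d_K)},1) ≠ 0`). The same «costume modulo Link A» as cn100's
`linkB_iff_torsionHalf`; here Link A-corank is NOT a kernel theorem (only its rank form is, mod PT), so the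
collapse is conditional and Link B stays an honest stub today — but a planner should expect the research
content of a links skeleton to sit in Link A-corank, and re-cut Link B as a pinned-`𝓛` BDP triple
(TRANSFER note (c201-L3)) only if a rigid `2`-adic `L`-function frame at the additive prime gets typed.

§5 EXACTNESS: `atAnyTwo_iff_twoAdicLinks` — granted {2-parity, Modularity, Hoffstein–Luo, GZK, Gross–Zagier,
Gross 1984, Burungale–Tian rank-0, BCST Thm A (item 20045), Poitou–Tate}: **K12₂′ ⟺ Link A-corank ∧ Link B**.
The two typed links are therefore neither weaker nor stronger than the route's rank axis at `2` (modulo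
published inputs + the textbook PT): an exact re-coordinatisation, not progress. BSD is not touched.

PARTITION: none (RANK axis). References: [CastellaGrossiLeeSkinner2022] §5.2; [BurungaleTian2026] Thm. 1.1
(rank 0); [BurungaleCastellaSkinnerTian2022] Thm. A, Rem. D; [GrossZagier1986] Thm. I.6.3, I.§7;
[Greenberg1999LNM] §1; [Dokchitser2013ParityNotes] §4; [MilneADT2006] I Thm. 4.10(b); [SilvermanAEC2009]
IV.6.4, VII.6.3, X.5.4.1.
-/

noncomputable section

open scoped Classical

namespace Summit.BirchSwinnertonDyer.BirchSwinnertonDyer.Theorems.GoldfeldGoodTwists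

open WeierstrassCurve NumberField IsDedekindDomain Field Literature.NumberTheory.EllipticCurves
  Literature.NumberTheory.EllipticCurves.Castella2018
open Literature.NumberTheory.GaloisCohomology (poitouTate_sum_localTatePairing_eq_zero)
open Summit.BirchSwinnertonDyer.Rank1Residual
open Summit.BirchSwinnertonDyer.BirchSwinnertonDyer.Theses.GoldfeldAllTwistsTwoConverse
  (RankOneTwoConverseCMSevenAtAnyTwo RankOneTwoConverseCMSevenAdditiveTwo BCSTThmARankOneConverse)
open Summit.BirchSwinnertonDyer.BirchSwinnertonDyer.Theorems.CongruentShaFreeCutLinkBStructure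
  (charValueEqLogSqAt_of_hasCharValuationAt_of_not_isOfFinAddOrder charValueEqLogSqAt_iff_not_isOfFinAddOrder)

/-! ## §1 Rank = corank₂ = analytic rank for `j = −3375` in corank ≤ 1, granted the parent K12₂′ -/

/-- **`rank V(ℚ) = corank_{ℤ₂} Sel_{2^∞}(V)` for every elliptic `V/ℚ` with `j = −3375` and corank `≤ 1`**,
granted K12₂′ (`h12`) and GZK over `ℚ` (`hGZK`): corank `0` forces rank `0` (`corank = rank + corank Ш`),
corank `1` gives `ord L = 1` by K12₂′ and then rank `1` by GZK. Model-free.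
[cite: Greenberg1999LNM, §1 pp. 54–57] [cite: GrossZagier1986, Thm. I.(6.3) and I.§7] -/
theorem mordellWeilRank_eq_selmerCorank_two_of_le_one (h12 : RankOneTwoConverseCMSevenAtAnyTwo)
    (hGZK : rank_eq_analyticRank_of_analyticRank_le_one) (V : WeierstrassCurve ℚ) [V.IsElliptic]
    (hj : V.j = -3375) (hle : V.selmerCorank 2 ≤ 1) : V.mordellWeilRank = V.selmerCorank 2 := by
  have h := V.selmerCorank_eq_mordellWeilRank_add_holds 2
  obtain h0 | h1 : V.selmerCorank 2 = 0 ∨ V.selmerCorank 2 = 1 := by omega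
  · omega
  · have hr : V.analyticRank = 1 := h12 V (Or.inl hj) h1
    have hrk := (hGZK V (by omega)).1
    omega

/-- **`ord_{s=1} L(V,s) = corank_{ℤ₂} Sel_{2^∞}(V)` for every elliptic `V/ℚ` with `j = −3375` and corank `≤ 1`**,
granted K12₂′ (`h12`) and the Burungale–Tian rank-ZERO converse for CM curves (`hBT`; `V` has CM by
`hasCM_of_j_eq_neg3375`). Model-free. [cite: BurungaleTian2026, Thm. 1.1 (rank zero p-converse for CM curves)]
[cite: BurungaleCastellaSkinnerTian2022, Thm. A and Rem. D] -/
theorem analyticRank_eq_selmerCorank_two_of_le_one (h12 : RankOneTwoConverseCMSevenAtAnyTwo)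
    (hBT : burungaleTian_analyticRank_eq_zero_of_selmerCorank_eq_zero_of_hasCM)
    (V : WeierstrassCurve ℚ) [V.IsElliptic] (hj : V.j = -3375) (hle : V.selmerCorank 2 ≤ 1) :
    V.analyticRank = V.selmerCorank 2 := by
  obtain h0 | h1 : V.selmerCorank 2 = 0 ∨ V.selmerCorank 2 = 1 := by omega
  · rw [h0]
    exact hBT V (hasCM_of_j_eq_neg3375 V hj) 2 h0
  · rw [h1]
    exact h12 V (Or.inl hj) h1

/-! ## §2 Over a quadratic field: corank one forces rank one, finite Ш and `ord_{s=1} L(W/K,s) = 1` -/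

/-- **Corank one over `K` ⟹ rank one and finite `Ш[2^∞]` over `K`**, for elliptic `W/ℚ` with `j = −3375`
and `K` quadratic, granted K12₂′ and GZK: `corank(W/K) = corank W + corank W^{(d_K)} = 1`
(`selmerCorank_baseChange_quadratic_holds`), both summands `≤ 1` with `j = −3375`
(`j_quadraticTwist`), so each curve has rank = corank (§1); `rank W(K) = rank W + rank W^{(d_K)} = 1`
(`mordellWeilRank_baseChange_quadratic_holds`) and `corank Ш(W/K)[2^∞] = corank − rank = 0`.
[cite: Dokchitser2013ParityNotes, §4, first display] [cite: Greenberg1999LNM, §1 pp. 54–57] -/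
theorem rankOne_finiteSha_baseChange_of_atAnyTwo (h12 : RankOneTwoConverseCMSevenAtAnyTwo)
    (hGZK : rank_eq_analyticRank_of_analyticRank_le_one) (W : WeierstrassCurve ℚ) [W.IsElliptic]
    (hj : W.j = -3375) {K : Type} [Field K] [NumberField K] (h2 : Module.finrank ℚ K = 2)
    (hcK : (W.baseChange K).selmerCorank 2 = 1) :
    (W.baseChange K).mordellWeilRank = 1 ∧
      Finite (AddCommGroup.primaryComponent (W.baseChange K).sha 2) := by
  have hd : (NumberField.discr K : ℚ) ≠ 0 := by exact_mod_cast NumberField.discr_ne_zero K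
  haveI := W.isElliptic_quadraticTwist hd
  haveI : (W.baseChange K).IsElliptic := by rw [baseChange]; infer_instance
  have hsum := selmerCorank_baseChange_quadratic_holds W K h2 2
  rw [hcK] at hsum
  have hjt : (W.quadraticTwist (NumberField.discr K : ℚ)).j = -3375 := by
    rw [W.j_quadraticTwist hd, hj]
  have hra := mordellWeilRank_eq_selmerCorank_two_of_le_one h12 hGZK W hj (by omega)
  have hrb := mordellWeilRank_eq_selmerCorank_two_of_le_one h12 hGZK _ hjt (by omega)
  have hrK : (W.baseChange K).mordellWeilRank = 1 := by
    rw [mordellWeilRank_baseChange_quadratic_holds W K h2, hra, hrb]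
    omega
  refine ⟨hrK, ?_⟩
  rw [finite_primaryComponent_sha_iff_shaCorank_eq_zero (W.baseChange K) 2]
  have h := (W.baseChange K).selmerCorank_eq_mordellWeilRank_add_holds 2
  omega

/-- **Corank one over `K` ⟹ `ord_{s=1} L(W/K, s) = 1`**, for elliptic `W/ℚ` with `j = −3375` and `K`
quadratic, granted K12₂′, Burungale–Tian rank-0 and analytic continuation (`hmod`): Artin formalism
`ord L(W/K) = ord L(W) + ord L(W^{(d_K)})` (`analyticRankEK_eq_add_of`) and §1 on each summand.
[cite: GrossZagier1986, I.§7] [cite: BurungaleTian2026, Thm. 1.1 (rank zero p-converse for CM curves)] -/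
theorem analyticRankEK_eq_one_of_atAnyTwo (h12 : RankOneTwoConverseCMSevenAtAnyTwo)
    (hBT : burungaleTian_analyticRank_eq_zero_of_selmerCorank_eq_zero_of_hasCM)
    (hmod : hasEntireLFunction_rat) (W : WeierstrassCurve ℚ) [W.IsElliptic] (hj : W.j = -3375)
    {K : Type} [Field K] [NumberField K] (h2 : Module.finrank ℚ K = 2)
    (hcK : (W.baseChange K).selmerCorank 2 = 1) : analyticRankEK W K = 1 := by
  have hd : (NumberField.discr K : ℚ) ≠ 0 := by exact_mod_cast NumberField.discr_ne_zero K
  haveI := W.isElliptic_quadraticTwist hd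
  have hsum := selmerCorank_baseChange_quadratic_holds W K h2 2
  rw [hcK] at hsum
  have hjt : (W.quadraticTwist (NumberField.discr K : ℚ)).j = -3375 := by
    rw [W.j_quadraticTwist hd, hj]
  rw [analyticRankEK_eq_add_of hmod W K,
    analyticRank_eq_selmerCorank_two_of_le_one h12 hBT W hj (by omega),
    analyticRank_eq_selmerCorank_two_of_le_one h12 hBT _ hjt (by omega)]
  omega

/-! ## §3 Necessity of Link A-corank -/

/-- **LINK A-CORANK IS NECESSARY FOR THE PARENT K12₂′** (modulo GZK and Poitou–Tate at the imaginary
quadratic fields): at a datum of `TwoAdicControlOfCorankOneCMSeven` (corank one over `K`), §2 gives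
`rank W(K) = 1 ∧ #Ш(W/K)[2^∞] < ∞`, and the RANK form of the control conclusion is the links file's kernel
theorem `hasCharValuationAt_of_rankOne_of_poitouTate` (`2` splits in `K` by the Heegner hypothesis for `2`).
The binders `hbad`, `hN`, `hHN`, `ι`, `v`, `hv`, `hne` are not used. CONDITIONAL; credits nothing.
[cite: MilneADT2006, Ch. I, Thm. 4.10(b) (hypothesis kept)] [cite: JetchevSkinnerWan2017, Prop. 3.2.1 and §3.3] -/
theorem twoAdicControlOfCorankOneCMSeven_of_atAnyTwo_of_poitouTate (h12 : RankOneTwoConverseCMSevenAtAnyTwo)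
    (hGZK : rank_eq_analyticRank_of_analyticRank_le_one)
    (hPT : ∀ (K : Type) [Field K] [NumberField K], IsImaginaryQuadratic K →
      poitouTate_sum_localTatePairing_eq_zero K) :
    TwoAdicControlOfCorankOneCMSeven := by
  intro W _ _ hj _hbad K _ _ _N _ _hN hK _hHN hH2 _ι _v vbar _hv hvbar _hne κ hκ γ _ hcK
  obtain ⟨hrK, hShaK⟩ := rankOne_finiteSha_baseChange_of_atAnyTwo h12 hGZK W hj hK.1 hcK
  exact hasCharValuationAt_of_rankOne_of_poitouTate W 2 (hPT K hK) hK (hH2 2 Fact.out (dvd_refl 2)) κ hκ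
    γ vbar hvbar hrK hShaK

/-- **Link A-corank from the crux K12₂″ itself + BCST Thm A** (item 20045, the route's other rank-axis
cell) + GZK + Poitou–Tate — through the CLOSED glue `rankOneTwoConverseCMSevenAtAnyTwo_of_cells`
(item 20046). So every proof of the route's rank axis at `2` proves Link A-corank (mod PT).
[cite: BurungaleCastellaSkinnerTian2022, Thm. A and Rem. D (p. 327)] [cite: MilneADT2006, Ch. I, Thm. 4.10(b)] -/
theorem twoAdicControlOfCorankOneCMSeven_of_crux_of_thmA_of_poitouTate
    (hcrux : RankOneTwoConverseCMSevenAdditiveTwo) (hThmA : BCSTThmARankOneConverse)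
    (hGZK : rank_eq_analyticRank_of_analyticRank_le_one)
    (hPT : ∀ (K : Type) [Field K] [NumberField K], IsImaginaryQuadratic K →
      poitouTate_sum_localTatePairing_eq_zero K) :
    TwoAdicControlOfCorankOneCMSeven :=
  twoAdicControlOfCorankOneCMSeven_of_atAnyTwo_of_poitouTate
    (rankOneTwoConverseCMSevenAtAnyTwo_of_cells hcrux hThmA) hGZK hPT

/-! ## §4 Link B from Link A-corank and the parent -/

/-- **LINK B FROM LINK A-CORANK + K12₂′** (+ Burungale–Tian rank-0, Modularity, Gross–Zagier): at a datum of
Link B, `ord_{s=1} L(W/K,s) = 1` (§2), so the Heegner point `P` is non-torsion (Gross–Zagier dictionary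
`analyticRankEK_eq_one_iff_heegner_nonTorsion_of_exists_isNewformOf`); Link A-corank supplies a generator with
`F(0) ≠ 0`, and `F(0) = u·log²(P)` with `u = F(0)/log² ≠ 0` (cn100's generic
`charValueEqLogSqAt_of_hasCharValuationAt_of_not_isOfFinAddOrder`; `log_ω P = 0 ↔ P` torsion).
CONDITIONAL on Link A-corank and K12₂′; credits nothing.
[cite: CastellaGrossiLeeSkinner2022, §5.2 (proof of Thm. 5.2.1) (shape)] [cite: GrossZagier1986, Thm. I.(6.3) with V.§2]
[cite: SilvermanAEC2009, IV.6.4 and VII.6.3] -/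
theorem twoAdicCharValueEqHeegnerLogSqCMSeven_of_controlCorank_of_atAnyTwo
    (hA : TwoAdicControlOfCorankOneCMSeven) (h12 : RankOneTwoConverseCMSevenAtAnyTwo)
    (hBT : burungaleTian_analyticRank_eq_zero_of_selmerCorank_eq_zero_of_hasCM)
    (hmod : ModularForms.exists_isNewformOf)
    (hGZ : ∀ (N : ℕ) [NeZero N] (W : WeierstrassCurve ℚ) (K : Type) [Field K] [NumberField K],
      gross_zagier N W K) :
    TwoAdicCharValueEqHeegnerLogSqCMSeven := by
  intro W _ _ hj hbad K _ _ N _ hN hK hHN hH2 ι v vbar hv hvbar hne κ hκ γ _ hcK P hP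
  have hEK : analyticRankEK W K = 1 :=
    analyticRankEK_eq_one_of_atAnyTwo h12 hBT (hasEntireLFunction_rat_of_exists_isNewformOf hmod) W hj
      hK.1 hcK
  have hnt : ¬ IsOfFinAddOrder P :=
    (analyticRankEK_eq_one_iff_heegner_nonTorsion_of_exists_isNewformOf W N K (hGZ N W K) hmod hK hN hHN
      hP).mp hEK
  exact charValueEqLogSqAt_of_hasCharValuationAt_of_not_isOfFinAddOrder ι
    (hA W hj hbad K N hN hK hHN hH2 ι v vbar hv hvbar hne κ hκ γ hcK) hnt

/-- **Granted Link A-corank, Link B ⟺ «corank one over `K` ⟹ level-`N_W` Heegner points non-torsion» over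
ALL auxiliary fields of the links** (no `L(W^{(d_K)},1) ≠ 0` restriction, unlike the leaf
`HeegnerNonTorsionCMSevenAdditiveTwo`): `→` is `AcPConverseLinks.not_isOfFinAddOrder_of_links` at the datum the
b2b adapter supplies, `←` is cn100's generic `charValueEqLogSqAt_of_hasCharValuationAt_of_not_isOfFinAddOrder`.
The «costume modulo Link A» finding of cn100 (`linkB_iff_torsionHalf`) for this cell.
[cite: CastellaGrossiLeeSkinner2022, §5.2 (proof of Thm. 5.2.1) (shape)] [cite: SilvermanAEC2009, IV.6.4 and VII.6.3] -/
theorem twoAdicCharValueEqHeegnerLogSqCMSeven_iff_heegnerNonTorsion_of_controlCorank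
    (hA : TwoAdicControlOfCorankOneCMSeven) :
    TwoAdicCharValueEqHeegnerLogSqCMSeven ↔
      ∀ (W : WeierstrassCurve ℚ) [W.IsElliptic] [W.IsGloballyMinimal], W.j = -3375 →
        ¬ W.HasGoodReductionAtPrime 2 →
        ∀ (K : Type) [Field K] [NumberField K] (N : ℕ) [NeZero N],
        W.conductorNorm ℤ = N → IsImaginaryQuadratic K →
          SatisfiesHeegnerHypothesis N K → SatisfiesHeegnerHypothesis 2 K →
          (W.baseChange K).selmerCorank 2 = 1 →
        ∀ (P : (W.baseChange K).toAffine.Point), IsHeegnerPoint N W K P → ¬ IsOfFinAddOrder P := by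
  constructor
  · intro hB W _ _ hj hbad K _ _ N _ hN hK hHN hH2 hcK P hP
    obtain ⟨κ, γ, 𝔭, hκ, hγ, h𝔭, he, hf⟩ :=
      X11b.exists_anticyclotomic_generator_degreeOnePrime 2 K hK hH2
    haveI : Fact (κ.IsTopGenerator γ) := ⟨hγ⟩
    let ι : K →+* ℚ_[2] := X11b.embAt K 2 𝔭 h𝔭 he hf
    obtain ⟨vbar, hvbar, hne⟩ :=
      X11b.exists_other_prime hH2 (X11b.inducedPlace ι) (X11b.natCast_mem_inducedPlace ι)
    have hv := X11b.mem_inducedPlace_iff ι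
    exact AcPConverseLinks.not_isOfFinAddOrder_of_links W 2 κ vbar γ ι P
      (hA W hj hbad K N hN hK hHN hH2 ι (X11b.inducedPlace ι) vbar hv hvbar hne κ hκ γ hcK)
      (hB W hj hbad K N hN hK hHN hH2 ι (X11b.inducedPlace ι) vbar hv hvbar hne κ hκ γ hcK P hP)
  · intro hNT W _ _ hj hbad K _ _ N _ hN hK hHN hH2 ι v vbar hv hvbar hne κ hκ γ _ hcK P hP
    exact charValueEqLogSqAt_of_hasCharValuationAt_of_not_isOfFinAddOrder ι
      (hA W hj hbad K N hN hK hHN hH2 ι v vbar hv hvbar hne κ hκ γ hcK) (hNT W hj hbad K N hN hK hHN hH2 hcK P hP)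

/-! ## §5 Exactness: K12₂′ ⟺ (Link A-corank ∧ Link B) modulo the route's published inputs + Poitou–Tate -/

/-- **Both links from the parent K12₂′** (+ GZK, Burungale–Tian rank-0, Modularity, Gross–Zagier,
Poitou–Tate): §3 and §4. [cite: BurungaleCastellaSkinnerTian2022, Thm. A and Rem. D]
[cite: MilneADT2006, Ch. I, Thm. 4.10(b) (hypothesis kept)] -/
theorem twoAdicLinks_of_atAnyTwo (h12 : RankOneTwoConverseCMSevenAtAnyTwo)
    (hGZK : rank_eq_analyticRank_of_analyticRank_le_one)
    (hBT : burungaleTian_analyticRank_eq_zero_of_selmerCorank_eq_zero_of_hasCM)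
    (hmod : ModularForms.exists_isNewformOf)
    (hGZ : ∀ (N : ℕ) [NeZero N] (W : WeierstrassCurve ℚ) (K : Type) [Field K] [NumberField K],
      gross_zagier N W K)
    (hPT : ∀ (K : Type) [Field K] [NumberField K], IsImaginaryQuadratic K →
      poitouTate_sum_localTatePairing_eq_zero K) :
    TwoAdicControlOfCorankOneCMSeven ∧ TwoAdicCharValueEqHeegnerLogSqCMSeven :=
  have hA := twoAdicControlOfCorankOneCMSeven_of_atAnyTwo_of_poitouTate h12 hGZK hPT
  ⟨hA, twoAdicCharValueEqHeegnerLogSqCMSeven_of_controlCorank_of_atAnyTwo hA h12 hBT hmod hGZ⟩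

/-- **The parent K12₂′ from the two links + BCST Thm A** (+ `2`-parity, Modularity, Hoffstein–Luo, GZK,
Gross–Zagier, Gross 1984): the links file's `rankOneTwoConverseCMSevenAdditiveTwo_of_twoAdicLinks` (K12₂″)
followed by the CLOSED glue 20046. CONDITIONAL; credits nothing.
[cite: BurungaleCastellaSkinnerTian2022, Thm. A and Rem. D] [cite: CastellaGrossiLeeSkinner2022, §5.2] -/
theorem atAnyTwo_of_twoAdicLinks_of_thmA
    (hpar : ∀ (W : WeierstrassCurve ℚ) [W.IsElliptic], p_parity W 2)
    (hmod : ModularForms.exists_isNewformOf) (hHL : HoffsteinLuo1997_exists_twist_L_one_ne_zero)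
    (hGZK : rank_eq_analyticRank_of_analyticRank_le_one)
    (hGZ : ∀ (N : ℕ) [NeZero N] (W : WeierstrassCurve ℚ) (K : Type) [Field K] [NumberField K],
      gross_zagier N W K)
    (hHP : ∀ (W : WeierstrassCurve ℚ) (K : Type) [Field K] [NumberField K], exists_isHeegnerPoint W K)
    (hThmA : BCSTThmARankOneConverse) (hA : TwoAdicControlOfCorankOneCMSeven)
    (hB : TwoAdicCharValueEqHeegnerLogSqCMSeven) : RankOneTwoConverseCMSevenAtAnyTwo :=
  rankOneTwoConverseCMSevenAtAnyTwo_of_cells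
    (rankOneTwoConverseCMSevenAdditiveTwo_of_twoAdicLinks hpar hmod hHL hGZK hGZ hHP hA hB) hThmA

/-- **EXACTNESS OF THE CUT: K12₂′ ⟺ (Link A-corank ∧ Link B)**, granted `2`-parity, Modularity,
Hoffstein–Luo, GZK, Gross–Zagier, Gross 1984, Burungale–Tian rank-0, BCST Thm A (item 20045) and Poitou–Tate at
the imaginary quadratic fields. An exact re-coordinatisation of the route's rank axis at `2` in the sibling
cell's currency — not progress on it; BSD is not touched. [cite: BurungaleCastellaSkinnerTian2022, Thm. A and Rem. D (p. 327)]
[cite: CastellaGrossiLeeSkinner2022, §5.2 (proof of Thm. 5.2.1)] [cite: MilneADT2006, Ch. I, Thm. 4.10(b)] -/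
theorem atAnyTwo_iff_twoAdicLinks
    (hpar : ∀ (W : WeierstrassCurve ℚ) [W.IsElliptic], p_parity W 2)
    (hmod : ModularForms.exists_isNewformOf) (hHL : HoffsteinLuo1997_exists_twist_L_one_ne_zero)
    (hGZK : rank_eq_analyticRank_of_analyticRank_le_one)
    (hGZ : ∀ (N : ℕ) [NeZero N] (W : WeierstrassCurve ℚ) (K : Type) [Field K] [NumberField K],
      gross_zagier N W K)
    (hHP : ∀ (W : WeierstrassCurve ℚ) (K : Type) [Field K] [NumberField K], exists_isHeegnerPoint W K)
    (hBT : burungaleTian_analyticRank_eq_zero_of_selmerCorank_eq_zero_of_hasCM)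
    (hThmA : BCSTThmARankOneConverse)
    (hPT : ∀ (K : Type) [Field K] [NumberField K], IsImaginaryQuadratic K →
      poitouTate_sum_localTatePairing_eq_zero K) :
    RankOneTwoConverseCMSevenAtAnyTwo ↔
      (TwoAdicControlOfCorankOneCMSeven ∧ TwoAdicCharValueEqHeegnerLogSqCMSeven) :=
  ⟨fun h12 ↦ twoAdicLinks_of_atAnyTwo h12 hGZK hBT hmod hGZ hPT,
    fun h ↦ atAnyTwo_of_twoAdicLinks_of_thmA hpar hmod hHL hGZK hGZ hHP hThmA h.1 h.2⟩

end Summit.BirchSwinnertonDyer.BirchSwinnertonDyer.Theorems.GoldfeldGoodTwists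

end
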